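import Summits.QuantumFields.BalabanUV.T4Continuum.Support.ScalarBlockTrialFunction

/-!
# T⁴ programme, spine node NE2 (U1a), tier B support row B4.c (iii), supplier «B4c-SIGMA-PLATEAU», file 1a — THE CAPPED TWO-SIDED
# RAMP `r(t) = min (1, (t+1)/m, (n−t)/m)` on the digits `{0,…,n−1}` of a block of [B5] (1.6)/(1.20): `0 ≤ r ≤ 1`,
# `r(0) = r(n−1) = 1/m`, `|r(t+1) − r(t)| ≤ 1/m`, `Σ_t r(t) ≥ n + 1 − m`, `Σ_{t+1<n} (r(t+1) − r(t))² ≤ 2(m−1)/m²`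

NE2 formalisation swarm `b2b-balaban-t4-ne2-formalise-*`, leaf 05 (gen 8), supplier item «B4c-SIGMA-PLATEAU» = the «σ₀ lever» of the
threshold census (leaf-05-g7 memo `t4/T4-NUM-NE2-D3-CT-THRESHOLD.md` §4: ROOT B's explicit threshold `NE2BalabanThreshold.etaStar` has
`KG ∝ σ₀⁻⁴` with `σ₀ = ScalarAveragedCompression.sigma0 d a′ = (36^d(4d + a′))⁻¹`, the variational coercivity constant of the
`U = 1` compression `Q′G′Q′*` obtained by leaf-09 from the PARABOLA bump `b(t) = (t+1)(n−t)/n²` of `ScalarBlockTrialFunction`, whose block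
weight is `β₁ → 1/6`).  The factor `36^{−d}` is an artefact of that bump, not of the problem: a trial function which is `≡ φ(y)` on
the bulk of the block and ramps linearly to `φ(y)/m` over the `m` sites nearest to each face has block weight `β ≥ 1 − (m−1)/n` and
Dirichlet energy `O(n^{d+1}/m)` per unit `nsq φ`.  This file is the one-dimensional profile of that trial function (file 1b
`Support/ScalarBlockPlateauFunction` builds the `d`-dimensional weight and proves the three estimates; file 2
`Support/ScalarAveragedCompressionSharp` feeds them into leaf-09's variational bound):

 * the RAMP `ramp n m t = min 1 (min ((t+1)/m) ((n−t)/m))`: `ramp_mem` (`0 ≤ r ≤ 1`), `ramp_sq_le`, `ramp_face` (`r(0) = r(n−1) = 1/m`),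
   `ramp_symm`, `abs_ramp_step_le` (`|r(t+1) − r(t)| ≤ 1/m`), `ramp_step_eq_zero` (`= 0` when `m ≤ t + 1` and `t + 1 + m ≤ n`),
   `rampStep_sq_le` (domination by the two indicators `𝟙[t+1 < m] + 𝟙[n < t+1+m]`), the lower bound `ramp_ge`
   (`r(t) ≥ 1 − (1 − (t+1)/m)₊ − (1 − (n−t)/m)₊`), the one-sided ramp sum `sum_pos_part_le` (`Σ_{t<n} (1 − (t+1)/m)₊ ≤ (m−1)/2`), whence
   **`sum_ramp_ge`** (`Σ_{t<n} r(t) ≥ n + 1 − m`, the falling side by the reflection `t ↦ n − 1 − t`), `sum_ramp_sq_le` (`Σ r² ≤ Σ r`), and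
   the step count **`sum_rampStep_sq_le`** (`Σ_{t+1<n} (r(t+1) − r(t))² ≤ 2(m−1)/m²`: only the `m − 1` rising and `m − 1` falling steps
   contribute, each at most `1/m²`).

HONEST FRAMING (T4-DAG p. 1).  [folklore] elementary real inequalities and finite sums; statements / constants OURS; nothing printed is a
hypothesis.  A SUPPORT input of rows B4.b/B4.c (it changes no binder of ROOT B — only the SIZE of its explicit threshold), NOT B4, NOT
[B9] (3.23)–(3.26) as printed; NE2 NOT proved; spine 0/9 unchanged; NOT infinite volume / mass gap / Clay / summit progress.  HONEST
DEPENDENCY: continuum YM on T⁴ ⇐ BetaPertH ∧ nine spine estimates (0/9 proved); BetaPertH ⇐ (D1) ∧ (D4) ∧ CAP+tail; G-an2-4 gates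
asym, D1 and NE2/3/4.  ABSOLUTE RULE kept; zero sorries.
-/

noncomputable section

open scoped BigOperators
open Finset

namespace Summit.QuantumFields.BalabanUV.T4Continuum.ScalarBlockPlateauRamp

/-! ## §1 The capped two-sided ramp -/

section Ramp

/-- the capped two-sided ramp of width `m` on the digits `{0,…,n−1}`: `r(t) = min (1, (t+1)/m, (n−t)/m)`. [folklore] -/
def ramp (n m t : ℕ) : ℝ := min 1 (min (((t : ℝ) + 1) / m) (((n : ℝ) - t) / m))

variable {n m : ℕ}

/-- `0 ≤ r(t) ≤ 1` for `t < n`. [folklore] -/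
theorem ramp_mem (t : ℕ) (ht : t < n) : 0 ≤ ramp n m t ∧ ramp n m t ≤ 1 := by
  have ht' : (t : ℝ) + 1 ≤ n := by exact_mod_cast ht
  refine ⟨?_, min_le_left _ _⟩
  unfold ramp
  refine le_min zero_le_one (le_min ?_ ?_)
  · positivity
  · exact div_nonneg (by linarith) (Nat.cast_nonneg m)

/-- `r(t)² ≤ r(t)` for `t < n`. [folklore] -/
theorem ramp_sq_le (t : ℕ) (ht : t < n) : ramp n m t ^ 2 ≤ ramp n m t := by
  have h := ramp_mem (m := m) t ht
  nlinarith [h.1, h.2]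

/-- at the two faces the ramp equals `1/m`: `r(0) = 1/m` and `r(t) = 1/m` when `t + 1 = n` (`1 ≤ m`, `1 ≤ n`). [folklore] -/
theorem ramp_face (hm : 1 ≤ m) (hn : 1 ≤ n) (t : ℕ) (ht : t + 1 = n) : ramp n m 0 = 1 / m ∧ ramp n m t = 1 / m := by
  have hm' : (1 : ℝ) ≤ m := by exact_mod_cast hm
  have hn' : (1 : ℝ) ≤ n := by exact_mod_cast hn
  have hm0 : (0 : ℝ) < m := by linarith
  have h1m : (1 : ℝ) / m ≤ 1 := by rw [div_le_one hm0]; exact hm'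
  have ht' : (n : ℝ) - t = 1 := by
    have : (n : ℝ) = t + 1 := by exact_mod_cast ht.symm
    linarith
  constructor
  · unfold ramp
    rw [Nat.cast_zero, zero_add, sub_zero]
    have h2 : (1 : ℝ) / m ≤ (n : ℝ) / m := div_le_div_of_nonneg_right hn' hm0.le
    rw [min_eq_left h2, min_eq_right h1m]
  · unfold ramp
    rw [ht']
    have h2 : (1 : ℝ) / m ≤ ((t : ℝ) + 1) / m := div_le_div_of_nonneg_right (by linarith [(Nat.cast_nonneg t : (0 : ℝ) ≤ t)]) hm0.le
    rw [min_eq_right h2, min_eq_right h1m]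

/-- the symmetry `r(s) = r(t)` for `s + t + 1 = n`. [folklore] -/
theorem ramp_symm (s t : ℕ) (h : s + t + 1 = n) : ramp n m s = ramp n m t := by
  have h' : (n : ℝ) = s + t + 1 := by exact_mod_cast h.symm
  unfold ramp
  rw [min_comm (((s : ℝ) + 1) / m)]
  congr 2
  · congr 1; linarith
  · congr 1; linarith

/-- the ramp is `(1/m)`-Lipschitz: `|r(t+1) − r(t)| ≤ 1/m`. [folklore] -/
theorem abs_ramp_step_le (hm : 1 ≤ m) (t : ℕ) : |ramp n m (t + 1) - ramp n m t| ≤ 1 / m := by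
  have hm0 : (0 : ℝ) < m := by exact_mod_cast hm
  unfold ramp
  refine (abs_min_sub_min_le_max _ _ _ _).trans ?_
  rw [sub_self, abs_zero]
  refine max_le (by positivity) ?_
  refine (abs_min_sub_min_le_max _ _ _ _).trans (max_le ?_ ?_)
  · rw [← sub_div, abs_div, abs_of_pos hm0]
    refine div_le_div_of_nonneg_right ?_ hm0.le
    push_cast
    rw [show (t : ℝ) + 1 + 1 - (t + 1) = 1 by ring, abs_one]
  · rw [← sub_div, abs_div, abs_of_pos hm0]
    refine div_le_div_of_nonneg_right ?_ hm0.le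
    push_cast
    rw [show (n : ℝ) - (t + 1) - (n - t) = -1 by ring, abs_neg, abs_one]

/-- on the plateau the ramp is constant: `r(t+1) − r(t) = 0` when `m ≤ t + 1` and `t + 1 + m ≤ n`. [folklore] -/
theorem ramp_step_eq_zero (hm : 1 ≤ m) (t : ℕ) (h1 : m ≤ t + 1) (h2 : t + 1 + m ≤ n) :
    ramp n m (t + 1) - ramp n m t = 0 := by
  have hm0 : (0 : ℝ) < m := by exact_mod_cast hm
  have h1' : (m : ℝ) ≤ t + 1 := by exact_mod_cast h1
  have h2' : (t : ℝ) + 1 + m ≤ n := by exact_mod_cast h2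
  have e1 : ramp n m t = 1 := by
    unfold ramp
    refine min_eq_left (le_min ?_ ?_)
    · rw [le_div_iff₀ hm0, one_mul]; exact h1'
    · rw [le_div_iff₀ hm0, one_mul]; linarith
  have e2 : ramp n m (t + 1) = 1 := by
    unfold ramp
    refine min_eq_left (le_min ?_ ?_)
    · rw [le_div_iff₀ hm0, one_mul]; push_cast; linarith
    · rw [le_div_iff₀ hm0, one_mul]; push_cast; linarith
  rw [e1, e2, sub_self]

/-- hence `(r(t+1) − r(t))² ≤ m⁻²·(𝟙[t + 1 < m] + 𝟙[n < t + 1 + m])`. [folklore] -/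
theorem rampStep_sq_le (hm : 1 ≤ m) (t : ℕ) :
    (ramp n m (t + 1) - ramp n m t) ^ 2 ≤
      (1 / (m : ℝ) ^ 2) * ((if t + 1 < m then 1 else 0) + (if n < t + 1 + m then 1 else 0)) := by
  have hm0 : (0 : ℝ) < m := by exact_mod_cast hm
  by_cases h1 : t + 1 < m
  · rw [if_pos h1]
    have hs := abs_ramp_step_le (n := n) hm t
    have hsq : (ramp n m (t + 1) - ramp n m t) ^ 2 ≤ (1 / (m : ℝ)) ^ 2 := by
      rw [← sq_abs]; exact pow_le_pow_left₀ (abs_nonneg _) hs 2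
    have h0 : (0 : ℝ) ≤ if n < t + 1 + m then 1 else 0 := by split_ifs <;> norm_num
    calc _ ≤ (1 / (m : ℝ)) ^ 2 := hsq
      _ = 1 / (m : ℝ) ^ 2 * (1 + 0) := by rw [one_div_pow]; ring
      _ ≤ _ := by gcongr
  · rw [if_neg h1]
    by_cases h2 : n < t + 1 + m
    · rw [if_pos h2, zero_add, mul_one, ← one_div_pow, ← sq_abs]
      exact pow_le_pow_left₀ (abs_nonneg _) (abs_ramp_step_le (n := n) hm t) 2
    · rw [if_neg h2, add_zero, mul_zero, ramp_step_eq_zero hm t (not_lt.mp h1) (not_lt.mp h2)]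
      simp

/-- the lower bound `r(t) ≥ 1 − (1 − (t+1)/m)₊ − (1 − (n−t)/m)₊`. [folklore] -/
theorem ramp_ge (t : ℕ) :
    1 - max (1 - ((t : ℝ) + 1) / m) 0 - max (1 - ((n : ℝ) - t) / m) 0 ≤ ramp n m t := by
  unfold ramp
  simp only [min_def, max_def]
  split_ifs <;> linarith

/-- the one-sided ramp sum `Σ_{t<n} (1 − (t+1)/m)₊ ≤ (m−1)/2` (`1 ≤ m`). [folklore] -/
theorem sum_pos_part_le (hm : 1 ≤ m) (n : ℕ) :
    ∑ t ∈ Finset.range n, max (1 - ((t : ℝ) + 1) / m) 0 ≤ ((m : ℝ) - 1) / 2 := by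
  have hm0 : (0 : ℝ) < m := by exact_mod_cast hm
  have hcast : ((m - 1 : ℕ) : ℝ) = (m : ℝ) - 1 := by rw [Nat.cast_sub hm, Nat.cast_one]
  have hgauss : ∀ k : ℕ, ∑ t ∈ Finset.range k, ((t : ℝ) + 1) = (k : ℝ) * ((k : ℝ) + 1) / 2 := by
    intro k
    induction k with
    | zero => simp
    | succ k ih => rw [Finset.sum_range_succ, ih]; push_cast; ring
  -- each summand is `(m − 1 − t)₊/m`, nonzero only for `t < m − 1`
  have hterm : ∀ t : ℕ, max (1 - ((t : ℝ) + 1) / m) 0 = (if t < m - 1 then ((m : ℝ) - 1 - t) / m else 0) := by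
    intro t
    by_cases h : t < m - 1
    · rw [if_pos h]
      have h' : (t : ℝ) + 1 ≤ (m : ℝ) - 1 := by
        have h2 : ((t + 1 : ℕ) : ℝ) ≤ ((m - 1 : ℕ) : ℝ) := by exact_mod_cast h
        rw [hcast] at h2; push_cast at h2; exact h2
      rw [max_eq_left]
      · field_simp; ring
      · rw [sub_nonneg, div_le_one hm0]; linarith
    · rw [if_neg h]
      have h' : (m : ℝ) - 1 ≤ t := by
        have h2 : ((m - 1 : ℕ) : ℝ) ≤ (t : ℝ) := by exact_mod_cast not_lt.mp h
        rw [hcast] at h2; exact h2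
      refine max_eq_right ?_
      rw [sub_nonpos, one_le_div hm0]; linarith
  simp_rw [hterm]
  rw [← Finset.sum_filter]
  -- the filtered index set sits inside `range (m − 1)`, where the summands are nonnegative
  have hsub : (Finset.range n).filter (fun t => t < m - 1) ⊆ Finset.range (m - 1) := by
    intro t ht
    rw [Finset.mem_filter] at ht
    exact Finset.mem_range.mpr ht.2
  have hnn : ∀ t ∈ Finset.range (m - 1), t ∉ (Finset.range n).filter (fun t => t < m - 1) → 0 ≤ ((m : ℝ) - 1 - t) / m := by
    intro t ht _
    have h2 : ((t + 1 : ℕ) : ℝ) ≤ ((m - 1 : ℕ) : ℝ) := by exact_mod_cast Finset.mem_range.mp ht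
    rw [hcast] at h2; push_cast at h2
    exact div_nonneg (by linarith) hm0.le
  refine (Finset.sum_le_sum_of_subset_of_nonneg hsub hnn).trans ?_
  -- `Σ_{t < m−1} (m − 1 − t) = Σ_{t < m−1} (t + 1) = (m−1)m/2`
  have hrefl : ∑ t ∈ Finset.range (m - 1), ((m : ℝ) - 1 - t) / m = ∑ t ∈ Finset.range (m - 1), ((t : ℝ) + 1) / m := by
    have h := Finset.sum_range_reflect (fun t : ℕ => ((t : ℝ) + 1) / m) (m - 1)
    rw [← h]
    refine Finset.sum_congr rfl fun t ht => ?_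
    have ht' : t < m - 1 := Finset.mem_range.mp ht
    have e : ((m - 1 - 1 - t : ℕ) : ℝ) = (m : ℝ) - 1 - 1 - t := by
      rw [Nat.cast_sub (by omega), Nat.cast_sub (by omega), hcast]; push_cast; ring
    rw [e]; ring
  rw [hrefl, ← Finset.sum_div, hgauss (m - 1), hcast]
  have e : ((m : ℝ) - 1) * ((m : ℝ) - 1 + 1) / 2 / m = ((m : ℝ) - 1) / 2 := by
    field_simp; ring
  rw [e]

/-- **the ramp sum**: `S₁ = Σ_{t<n} r(t) ≥ n + 1 − m`. [folklore] -/
theorem sum_ramp_ge (hm : 1 ≤ m) : (n : ℝ) + 1 - m ≤ ∑ t : Fin n, ramp n m t := by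
  have hP : ∑ t : Fin n, max (1 - (((t : ℕ) : ℝ) + 1) / m) 0 ≤ ((m : ℝ) - 1) / 2 := by
    rw [Fin.sum_univ_eq_sum_range (fun t => max (1 - ((t : ℝ) + 1) / m) 0) n]
    exact sum_pos_part_le hm n
  have hQ : ∑ t : Fin n, max (1 - ((n : ℝ) - ((t : ℕ) : ℝ)) / m) 0 = ∑ t : Fin n, max (1 - (((t : ℕ) : ℝ) + 1) / m) 0 := by
    rw [← Equiv.sum_comp Fin.revPerm (fun t : Fin n => max (1 - ((n : ℝ) - ((t : ℕ) : ℝ)) / m) 0)]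
    refine Finset.sum_congr rfl fun t _ => ?_
    have ht : (t : ℕ) + 1 ≤ n := t.is_lt
    simp only [Fin.revPerm_apply, Fin.val_rev]
    rw [Nat.cast_sub ht]
    push_cast
    ring_nf
  have hsum : ∑ t : Fin n, (1 - max (1 - (((t : ℕ) : ℝ) + 1) / m) 0 - max (1 - ((n : ℝ) - ((t : ℕ) : ℝ)) / m) 0)
      = (n : ℝ) - ∑ t : Fin n, max (1 - (((t : ℕ) : ℝ) + 1) / m) 0 - ∑ t : Fin n, max (1 - ((n : ℝ) - ((t : ℕ) : ℝ)) / m) 0 := by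
    rw [Finset.sum_sub_distrib, Finset.sum_sub_distrib, Finset.sum_const, Finset.card_univ, Fintype.card_fin]
    simp
  calc (n : ℝ) + 1 - m ≤ (n : ℝ) - ((m : ℝ) - 1) / 2 - ((m : ℝ) - 1) / 2 := by linarith
    _ ≤ ∑ t : Fin n, (1 - max (1 - (((t : ℕ) : ℝ) + 1) / m) 0 - max (1 - ((n : ℝ) - ((t : ℕ) : ℝ)) / m) 0) := by
        rw [hsum, hQ]; linarith
    _ ≤ ∑ t : Fin n, ramp n m t := Finset.sum_le_sum fun t _ => ramp_ge (t : ℕ)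

/-- `S₂ = Σ_t r(t)² ≤ S₁`. [folklore] -/
theorem sum_ramp_sq_le : ∑ t : Fin n, ramp n m t ^ 2 ≤ ∑ t : Fin n, ramp n m t :=
  Finset.sum_le_sum fun t _ => ramp_sq_le (t : ℕ) t.is_lt

/-- **the step count**: `A = Σ_{t+1<n} (r(t+1) − r(t))² ≤ 2(m−1)/m²` — only the `m − 1` rising and the `m − 1` falling steps
contribute, each at most `1/m²`. [folklore] -/
theorem sum_rampStep_sq_le (hm : 1 ≤ m) :
    ∑ t : Fin n, (if (t : ℕ) + 1 < n then (ramp n m ((t : ℕ) + 1) - ramp n m t) ^ 2 else 0)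
      ≤ 2 * ((m : ℝ) - 1) / (m : ℝ) ^ 2 := by
  have hm0 : (0 : ℝ) < m := by exact_mod_cast hm
  have hcast : ((m - 1 : ℕ) : ℝ) = (m : ℝ) - 1 := by rw [Nat.cast_sub hm, Nat.cast_one]
  -- termwise domination by the two indicators
  have hdom : ∀ t : Fin n, (if (t : ℕ) + 1 < n then (ramp n m ((t : ℕ) + 1) - ramp n m t) ^ 2 else 0)
      ≤ (1 / (m : ℝ) ^ 2) * ((if (t : ℕ) + 1 < m then 1 else 0) + (if (t : ℕ) + 1 < n ∧ n < (t : ℕ) + 1 + m then 1 else 0)) := by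
    intro t
    by_cases h : (t : ℕ) + 1 < n
    · rw [if_pos h]
      refine (rampStep_sq_le (n := n) hm (t : ℕ)).trans ?_
      gcongr
      by_cases h2 : n < (t : ℕ) + 1 + m
      · rw [if_pos h2, if_pos ⟨h, h2⟩]
      · rw [if_neg h2, if_neg (fun hh => h2 hh.2)]
    · rw [if_neg h]
      have h0 : (0 : ℝ) ≤ (if (t : ℕ) + 1 < m then (1 : ℝ) else 0) := by split_ifs <;> norm_num
      have h0' : (0 : ℝ) ≤ (if (t : ℕ) + 1 < n ∧ n < (t : ℕ) + 1 + m then (1 : ℝ) else 0) := by split_ifs <;> norm_num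
      positivity
  refine (Finset.sum_le_sum fun t _ => hdom t).trans ?_
  rw [← Finset.mul_sum, Finset.sum_add_distrib, Finset.sum_boole, Finset.sum_boole]
  -- the two index sets have at most `m − 1` elements each
  have hc1 : ((Finset.univ.filter fun t : Fin n => (t : ℕ) + 1 < m).card : ℝ) ≤ (m : ℝ) - 1 := by
    rw [← hcast]
    have h : (Finset.univ.filter fun t : Fin n => (t : ℕ) + 1 < m).card ≤ (Finset.range (m - 1)).card := by
      refine Finset.card_le_card_of_injOn (fun t : Fin n => (t : ℕ)) ?_ ?_
      · intro t ht
        simp only [Finset.coe_filter, Finset.mem_univ, true_and, Set.mem_setOf_eq] at ht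
        simp only [Finset.coe_range, Set.mem_Iio]
        omega
      · exact Fin.val_injective.injOn
    rw [Finset.card_range] at h
    exact_mod_cast h
  have hc2 : ((Finset.univ.filter fun t : Fin n => (t : ℕ) + 1 < n ∧ n < (t : ℕ) + 1 + m).card : ℝ) ≤ (m : ℝ) - 1 := by
    rw [← hcast]
    have h : (Finset.univ.filter fun t : Fin n => (t : ℕ) + 1 < n ∧ n < (t : ℕ) + 1 + m).card ≤ (Finset.range (m - 1)).card := by
      refine Finset.card_le_card_of_injOn (fun t : Fin n => (t : ℕ) + m - n) ?_ ?_
      · intro t ht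
        simp only [Finset.coe_filter, Finset.mem_univ, true_and, Set.mem_setOf_eq] at ht
        simp only [Finset.coe_range, Set.mem_Iio]
        omega
      · intro t ht t' ht' h
        simp only [Finset.coe_filter, Finset.mem_univ, true_and, Set.mem_setOf_eq] at ht ht'
        apply Fin.ext
        simp only at h
        omega
    rw [Finset.card_range] at h
    exact_mod_cast h
  calc 1 / (m : ℝ) ^ 2 * (((Finset.univ.filter fun t : Fin n => (t : ℕ) + 1 < m).card : ℝ)
        + ((Finset.univ.filter fun t : Fin n => (t : ℕ) + 1 < n ∧ n < (t : ℕ) + 1 + m).card : ℝ))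
      ≤ 1 / (m : ℝ) ^ 2 * (((m : ℝ) - 1) + ((m : ℝ) - 1)) := by gcongr
    _ = 2 * ((m : ℝ) - 1) / (m : ℝ) ^ 2 := by ring

end Ramp

end Summit.QuantumFields.BalabanUV.T4Continuum.ScalarBlockPlateauRamp

end
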